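import Summits.NavierStokesRegularity.NavierStokesRegularity.Theorems.RellichScarSymmetricScarExistsScarStabiliserClosed
import Summits.NavierStokesRegularity.NavierStokesRegularity.Theorems.RellichScarSymmetricScarExistsClosedSubgroupPlaneLine
import Summits.NavierStokesRegularity.NavierStokesRegularity.Theorems.RellichScarSymmetricScarExistsRdssCalibrations
import Summits.NavierStokesRegularity.NavierStokesRegularity.Theorems.RellichScarSymmetricScarExistsRotWindowRigidity
import Summits.NavierStokesRegularity.NavierStokesRegularity.Theorems.RellichScarSymmetricScarExistsScaleWindowRigidity
import Summits.NavierStokesRegularity.NavierStokesRegularity.Theorems.RellichScarSymmetricScarExistsSmallConstant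
import Summits.NavierStokesRegularity.NavierStokesRegularity.Theorems.RellichScarSymmetricScarExistsOrbitScarRigidity
import Summits.NavierStokesRegularity.NavierStokesRegularity.Theorems.SymmetricScarExists.Negative.RepairedAssembly
import Summits.NavierStokesRegularity.NavierStokesRegularity.Theorems.RellichScarAxisymmetricApexFatal
import Summits.NavierStokesRegularity.NavierStokesRegularity.Theorems.RellichScarSimilarityCovariance

/-!
# Crux `SymmetricScarExists` (stmt-NavierStokesRegularity-11718), line `rdss-screw-split` — the scar stabiliser
# dichotomy (lead c4, wave 3)

Support file of the line lead (`--supports stmt-NavierStokesRegularity-11718`; registered by-products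
`symmetricScarExistsSpiral_of_accumulatingSelection`, `noApexTypeIProfile_of_accumulatingSelection`).

The scar-fixing screws of an apex profile `u` (constant `C > 0`), in logarithmic coordinates `(a, θ) ↦ (e^a, θ)` of
the screw group `ℝ₊ × SO(2)`, form an additive subgroup of `ℝ × ℝ` (`scarStabiliser_addSubgroup`: the screws compose by
`screw_screw` and `SameScar` is an equivalence relation covariant under screws) which is CLOSED (`stub_scarStabiliserClosed`,
AUX-7: the scar moves continuously under the screws because of its cubic trace rate); a closed subgroup of the plane is
discrete at `0` or contains a line (`stub_closedSubgroupPlane_line`, AUX-8).  Hence the DICHOTOMY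
(`scarStabiliser_dichotomy`): either the identity is ISOLATED among the scar-fixing screws — the genuinely
screw-periodic case, where child C of the split needs the RDSS Liouville theorem at the isolated screw — or the scar is
fixed by a one-parameter subgroup: a spiral scar `SpiralScar α u` (`α = 0`: homogeneous) or an axisymmetric scar
`AxiScar u`, which is exactly the conclusion of the repaired crux `SymmetricScarExistsSpiral` (Disproof §4, §9).
Consequently an ACCUMULATING selection — child A with scar-fixing screws tending to the identity — proves the repaired
crux outright (`symmetricScarExistsSpiral_of_accumulatingSelection`), and with `ScarRigidity` and the rotated
self-similar Liouville theorems `RssApexFatal α` (Pineau–Vicol 2026, Conj. 1.1; proved for small and large pitch) it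
yields the route target `NoApexTypeIProfile` (`noApexTypeIProfile_of_accumulatingSelection`, via the landed
`Negative.noApexTypeIProfile_of_repaired`).  So the RDSS Liouville wall for LARGE factors is needed only for scars with an
isolated screw symmetry.

## References

* B. Pineau, V. Vicol, *Rotated self-similarity and Liouville theorems for Type-I ancient Navier–Stokes flows* (2026),
  arXiv:2607.09619, Conj. 1.1, Rem. 1.5, Thm 1.7. [PineauVicol2026]
* N. Bourbaki, *General Topology*, Ch. VII §1 no. 2 (closed subgroups of `ℝⁿ`). [folklore]
-/

noncomputable section

open MeasureTheory Set Function Filter Topology TopologicalSpace Metric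
open scoped NNReal ENNReal

namespace Summit.NavierStokesRegularity.NavierStokesRegularity.Theorems.SymmetricScarExists.RdssSplit.ScarLevel

set_option linter.dupNamespace false

open Literature.Analysis.FluidPDE
open Summit.NavierStokesRegularity.NavierStokesRegularity.Theses.RellichScar
open Summit.NavierStokesRegularity.NavierStokesRegularity.Theorems.SymmetricScarExists.Negative
open Summit.NavierStokesRegularity.NavierStokesRegularity.Theorems.SymmetricScarExists.ScarWindow

/-- The scar stabiliser of `u` in logarithmic coordinates `(a, θ) ↦ (e^a, θ)` of the screw group: the set of
`(a, θ)` with `SameScar (R_θ D_{e^a} u) u`, as an additive subgroup of `ℝ × ℝ` (the screws commute,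
`nsRescale_conjZ`, compose by `screw_screw`, and `SameScar` is an equivalence relation covariant under screws). [folklore] -/
theorem scarStabiliser_addSubgroup (u : ℝ → EuclideanSpace ℝ (Fin 3) → EuclideanSpace ℝ (Fin 3)) :
    ∃ S : AddSubgroup (ℝ × ℝ), ∀ s : ℝ × ℝ, s ∈ S ↔ SameScar (conjZ s.2 (nsRescale (Real.exp s.1) u)) u := by
  refine ⟨{ carrier := {s : ℝ × ℝ | SameScar (conjZ s.2 (nsRescale (Real.exp s.1) u)) u}
            add_mem' := ?_, zero_mem' := ?_, neg_mem' := ?_ }, fun s => Iff.rfl⟩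
  · rintro ⟨a, θ⟩ ⟨b, φ⟩ ha hb
    simp only [mem_setOf_eq, Prod.fst_add, Prod.snd_add] at ha hb ⊢
    -- R_{θ+φ} D_{e^{a+b}} u = R_θ D_{e^a} (R_φ D_{e^b} u)
    have e : conjZ (θ + φ) (nsRescale (Real.exp (a + b)) u) =
        conjZ θ (nsRescale (Real.exp a) (conjZ φ (nsRescale (Real.exp b) u))) := by
      rw [Real.exp_add,
        Summit.NavierStokesRegularity.NavierStokesRegularity.Theorems.SymmetricScarExists.RdssSplit.Orbit.screw_screw]
    rw [e]
    exact sameScar_trans (sameScar_conjZ θ (sameScar_nsRescale hb (Real.exp_pos a))) ha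
  · simp only [mem_setOf_eq, Prod.fst_zero, Prod.snd_zero, Real.exp_zero, nsRescale_one, conjZ_zero]
    exact sameScar_refl u
  · rintro ⟨a, θ⟩ ha
    simp only [mem_setOf_eq, Prod.fst_neg, Prod.snd_neg] at ha ⊢
    -- apply the inverse screw to both sides of `ha`
    have h := sameScar_conjZ (-θ) (sameScar_nsRescale ha (Real.exp_pos (-a)))
    have e : conjZ (-θ) (nsRescale (Real.exp (-a)) (conjZ θ (nsRescale (Real.exp a) u))) = u := by
      have h1 : Real.exp (-a) * Real.exp a = 1 := by rw [← Real.exp_add, neg_add_cancel, Real.exp_zero]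
      rw [Summit.NavierStokesRegularity.NavierStokesRegularity.Theorems.SymmetricScarExists.RdssSplit.Orbit.screw_screw,
        h1, nsRescale_one, neg_add_cancel, conjZ_zero]
    rw [e] at h
    exact sameScar_symm h

/-- **The scar stabiliser dichotomy** (lead c4, from AUX-7 + AUX-8).  For an apex profile with constant `C > 0`:
EITHER the identity is isolated among the screws `(e^a, θ)` fixing its scar (the stabiliser is discrete at the
identity — the genuinely screw-PERIODIC case, where child C needs the RDSS Liouville theorem for the isolated screw),
OR the scar is fixed by a whole one-parameter subgroup of `ℝ₊ × SO(2)`: a SPIRAL scar `SpiralScar α u` (pitch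
`α`; `α = 0` is the homogeneous scar `HomScar`) or an axisymmetric scar `AxiScar u` — the conclusion of the repaired
crux `SymmetricScarExistsSpiral`. [folklore] -/
theorem scarStabiliser_dichotomy
    (u : ℝ → EuclideanSpace ℝ (Fin 3) → EuclideanSpace ℝ (Fin 3)) (p : ℝ → EuclideanSpace ℝ (Fin 3) → ℝ)
    (G : ℝ → EuclideanSpace ℝ (Fin 3) → EuclideanSpace ℝ (Fin 3) →L[ℝ] EuclideanSpace ℝ (Fin 3)) (C : ℝ) (hC : 0 < C)
    (hsw : IsSuitableWeakSolutionOn (slab (EuclideanSpace ℝ (Fin 3)) (Iio (0 : ℝ)) isOpen_Iio) 1 0 u p)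
    (hwg : HasWeakSpatialGradientOn (slab (EuclideanSpace ℝ (Fin 3)) (Iio (0 : ℝ)) isOpen_Iio) u G)
    (hI : typeIBound (Iio (0 : ℝ) ×ˢ univ) u p G < ⊤) (hdec : HasTypeIDecay C u) :
    (∃ ε : ℝ, 0 < ε ∧ ∀ a θ : ℝ, SameScar (conjZ θ (nsRescale (Real.exp a) u)) u → (a, θ) ≠ (0, 0) → ε ≤ ‖(a, θ)‖) ∨
      ((∃ α : ℝ, SpiralScar α u) ∨ AxiScar u) := by
  obtain ⟨S, hS⟩ := scarStabiliser_addSubgroup u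
  by_cases hiso : ∃ ε : ℝ, 0 < ε ∧ ∀ s : ℝ × ℝ, s ∈ S → s ≠ 0 → ε ≤ ‖s‖
  · left
    obtain ⟨ε, hε, h⟩ := hiso
    exact ⟨ε, hε, fun a θ hs hne => h (a, θ) ((hS _).2 hs) hne⟩
  · right
    push Not at hiso
    -- the stabiliser is closed (AUX-7, sequentially)
    have hclosed : IsClosed (S : Set (ℝ × ℝ)) := by
      refine IsSeqClosed.isClosed fun s s₀ hs hlim => ?_
      rw [SetLike.mem_coe, hS]
      exact stub_scarStabiliserClosed u p G C hC hsw hwg hI hdec (fun j => Real.exp (s j).1) (fun j => (s j).2)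
        (Real.exp s₀.1) s₀.2 (fun j => Real.exp_pos _) (Real.exp_pos _)
        ((Real.continuous_exp.tendsto _).comp ((continuous_fst.tendsto _).comp hlim))
        ((continuous_snd.tendsto _).comp hlim) (fun j => (hS _).1 (hs j))
    -- hence contains a line (AUX-8)
    obtain ⟨⟨v₁, v₂⟩, hv, hline⟩ := stub_closedSubgroupPlane_line S hclosed
      (fun ε hε => by
        obtain ⟨s, hsS, hs0, hsε⟩ := hiso ε hε
        exact ⟨s, hsS, hs0, hsε⟩)
    have hmem : ∀ t : ℝ, SameScar (conjZ (t * v₂) (nsRescale (Real.exp (t * v₁)) u)) u := fun t => by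
      have h := (hS _).1 (hline t)
      simpa only [Prod.smul_mk, smul_eq_mul] using h
    by_cases hv₁ : v₁ = 0
    · -- the line is the rotation axis of the group: axisymmetric scar
      subst hv₁
      have hv₂ : v₂ ≠ 0 := by
        rintro rfl
        exact hv rfl
      right
      intro φ
      have h := hmem (φ / v₂)
      rwa [mul_zero, Real.exp_zero, nsRescale_one, div_mul_cancel₀ φ hv₂] at h
    · -- a transversal line: spiral scar of pitch `v₂ / (2 v₁)`
      left
      refine ⟨v₂ / (2 * v₁), fun lam hlam => ?_⟩
      have h := hmem (Real.log lam / v₁)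
      have e1 : Real.log lam / v₁ * v₁ = Real.log lam := div_mul_cancel₀ _ hv₁
      rw [e1, Real.exp_log hlam] at h
      have e2 : 2 * (v₂ / (2 * v₁)) * Real.log lam = Real.log lam / v₁ * v₂ := by
        field_simp
      rwa [e2]

/-- **An ACCUMULATING selection closes the repaired crux** `SymmetricScarExistsSpiral`: if from every singular apex
profile one can produce a singular apex profile (constant `C'`) whose scar is fixed by screws `(e^a, θ) ≠ (1, 0)`
arbitrarily close to the identity, then the repaired crux holds (by the dichotomy; `C' > 0` is forced by the
singularity). [folklore] -/
theorem symmetricScarExistsSpiral_of_accumulatingSelection :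
    (∀ C : ℝ, (∃ (u : ℝ → EuclideanSpace ℝ (Fin 3) → EuclideanSpace ℝ (Fin 3)) (p : ℝ → EuclideanSpace ℝ (Fin 3) → ℝ) (G : ℝ → EuclideanSpace ℝ (Fin 3) → EuclideanSpace ℝ (Fin 3) →L[ℝ] EuclideanSpace ℝ (Fin 3)), Literature.Analysis.FluidPDE.IsSuitableWeakSolutionOn (Literature.Analysis.FluidPDE.slab (EuclideanSpace ℝ (Fin 3)) (Set.Iio 0) isOpen_Iio) 1 0 u p ∧ Literature.Analysis.FluidPDE.HasWeakSpatialGradientOn (Literature.Analysis.FluidPDE.slab (EuclideanSpace ℝ (Fin 3)) (Set.Iio 0) isOpen_Iio) u G ∧ Literature.Analysis.FluidPDE.typeIBound (Set.Iio (0 : ℝ) ×ˢ Set.univ) u p G < ⊤ ∧ Literature.Analysis.FluidPDE.HasTypeIDecay C u ∧ Literature.Analysis.FluidPDE.IsBackwardSingularPoint u 0) → ∃ (C' : ℝ) (u : ℝ → EuclideanSpace ℝ (Fin 3) → EuclideanSpace ℝ (Fin 3)) (p : ℝ → EuclideanSpace ℝ (Fin 3) → ℝ) (G : ℝ → EuclideanSpace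 ℝ (Fin 3) → EuclideanSpace ℝ (Fin 3) →L[ℝ] EuclideanSpace ℝ (Fin 3)), Literature.Analysis.FluidPDE.IsSuitableWeakSolutionOn (Literature.Analysis.FluidPDE.slab (EuclideanSpace ℝ (Fin 3)) (Set.Iio 0) isOpen_Iio) 1 0 u p ∧ Literature.Analysis.FluidPDE.HasWeakSpatialGradientOn (Literature.Analysis.FluidPDE.slab (EuclideanSpace ℝ (Fin 3)) (Set.Iio 0) isOpen_Iio) u G ∧ Literature.Analysis.FluidPDE.typeIBound (Set.Iio (0 : ℝ) ×ˢ Set.univ) u p G < ⊤ ∧ Literature.Analysis.FluidPDE.HasTypeIDecay C' u ∧ Literature.Analysis.FluidPDE.IsBackwardSingularPoint u 0 ∧ ∀ ε : ℝ, 0 < ε → ∃ a θ : ℝ, Summit.NavierStokesRegularity.NavierStokesRegularity.Theorems.SymmetricScarExists.Negative.SameScar (Summit.NavierStokesRegularity.NavierStokesRegularity.Theorems.SymmetricScarExists.Negative.conjZ θ (Literature.Analysis.FluidPDE.nsRescale (Real.exp a) u)) u ∧ (a, θ) ≠ (0, 0) ∧ ‖(a, θ)‖ < ε) → Summit.NavierStokesRegularity.NavierStokesRegularity.Theorems.SymmetricScarExists.Negative.SymmetricScarExistsSpiral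 := by
  intro hAcc C hex
  obtain ⟨C', u, p, G, hsw, hwg, hI, hdec, hsing, hacc⟩ := hAcc C hex
  have hC' : 0 < C' := by
    by_contra hle
    push Not at hle
    refine Summit.NavierStokesRegularity.NavierStokesRegularity.Theorems.SymmetricScarExists.ScarWindow.not_isBackwardSingularPoint_of_ae_zero_slab (u := u) ?_ hsing
    filter_upwards [ae_restrict_mem (measurableSet_Iio.prod MeasurableSet.univ)] with w hw
    exact Summit.NavierStokesRegularity.NavierStokesRegularity.Theorems.SymmetricScarExists.ScarWindow.eq_zero_of_hasTypeIDecay_nonpos hle hdec hw.1 w.2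
  refine ⟨C', u, p, G, hsw, hwg, hI, hdec, hsing, ?_⟩
  rcases scarStabiliser_dichotomy u p G C' hC' hsw hwg hI hdec with ⟨ε, hε, hfar⟩ | h
  · exfalso
    obtain ⟨a, θ, hs, hne, hlt⟩ := hacc ε hε
    exact (not_le.2 hlt) (hfar a θ hs hne)
  · exact h

/-- **What an accumulating selection buys the route** (readback): granted `ScarRigidity` and the rotated self-similar
Liouville theorems `RssApexFatal α` for every pitch (Pineau–Vicol 2026 Conj. 1.1; proved for small and large `|α|`),
an accumulating selection yields the route target `NoApexTypeIProfile` — via the repaired crux and the landed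
`Negative.noApexTypeIProfile_of_repaired`, `similarityCovariance_proof`, `rellichScar_axisymmetricApexFatal_proof`.
[cite: PineauVicol2026, Conjecture 1.1 and Remark 1.5 (arXiv:2607.09619 pp. 3, 5)] -/
theorem noApexTypeIProfile_of_accumulatingSelection :
    Summit.NavierStokesRegularity.NavierStokesRegularity.Theses.RellichScar.ScarRigidity → (∀ α : ℝ, Summit.NavierStokesRegularity.NavierStokesRegularity.Theorems.SymmetricScarExists.Negative.RssApexFatal α) → (∀ C : ℝ, (∃ (u : ℝ → EuclideanSpace ℝ (Fin 3) → EuclideanSpace ℝ (Fin 3)) (p : ℝ → EuclideanSpace ℝ (Fin 3) → ℝ) (G : ℝ → EuclideanSpace ℝ (Fin 3) → EuclideanSpace ℝ (Fin 3) →L[ℝ] EuclideanSpace ℝ (Fin 3)), Literature.Analysis.FluidPDE.IsSuitableWeakSolutionOn (Literature.Analysis.FluidPDE.slab (EuclideanSpace ℝ (Fin 3)) (Set.Iio 0) isOpen_Iio) 1 0 u p ∧ Literature.Analysis.FluidPDE.HasWeakSpatialGradientOn (Literature.Analysis.FluidPDE.slab (EuclideanSpace ℝ (Fin 3)) (Set.Iio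 0) isOpen_Iio) u G ∧ Literature.Analysis.FluidPDE.typeIBound (Set.Iio (0 : ℝ) ×ˢ Set.univ) u p G < ⊤ ∧ Literature.Analysis.FluidPDE.HasTypeIDecay C u ∧ Literature.Analysis.FluidPDE.IsBackwardSingularPoint u 0) → ∃ (C' : ℝ) (u : ℝ → EuclideanSpace ℝ (Fin 3) → EuclideanSpace ℝ (Fin 3)) (p : ℝ → EuclideanSpace ℝ (Fin 3) → ℝ) (G : ℝ → EuclideanSpace ℝ (Fin 3) → EuclideanSpace ℝ (Fin 3) →L[ℝ] EuclideanSpace ℝ (Fin 3)), Literature.Analysis.FluidPDE.IsSuitableWeakSolutionOn (Literature.Analysis.FluidPDE.slab (EuclideanSpace ℝ (Fin 3)) (Set.Iio 0) isOpen_Iio) 1 0 u p ∧ Literature.Analysis.FluidPDE.HasWeakSpatialGradientOn (Literature.Analysis.FluidPDE.slab (EuclideanSpace ℝ (Fin 3)) (Set.Iio 0) isOpen_Iio) u G ∧ Literature.Analysis.FluidPDE.typeIBound (Set.Iio (0 : ℝ) ×ˢ Set.univ) u p G < ⊤ ∧ Literature.Analysis.FluidPDE.HasTypeIDecay C' u ∧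 Literature.Analysis.FluidPDE.IsBackwardSingularPoint u 0 ∧ ∀ ε : ℝ, 0 < ε → ∃ a θ : ℝ, Summit.NavierStokesRegularity.NavierStokesRegularity.Theorems.SymmetricScarExists.Negative.SameScar (Summit.NavierStokesRegularity.NavierStokesRegularity.Theorems.SymmetricScarExists.Negative.conjZ θ (Literature.Analysis.FluidPDE.nsRescale (Real.exp a) u)) u ∧ (a, θ) ≠ (0, 0) ∧ ‖(a, θ)‖ < ε) → Summit.NavierStokesRegularity.NavierStokesRegularity.Theses.RellichScar.NoApexTypeIProfile :=
  fun hSR hRss hAcc =>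
  noApexTypeIProfile_of_repaired hSR (symmetricScarExistsSpiral_of_accumulatingSelection hAcc)
    Summit.NavierStokesRegularity.NavierStokesRegularity.Theorems.RellichScarSimilarityCovariance.similarityCovariance_proof
    hRss Summit.NavierStokesRegularity.NavierStokesRegularity.Theorems.rellichScar_axisymmetricApexFatal_proof


end Summit.NavierStokesRegularity.NavierStokesRegularity.Theorems.SymmetricScarExists.RdssSplit.ScarLevel

end
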